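import Literature.MathematicalPhysics.QuantumFieldTheory.Balaban1983to89.B4Prop23TorusRegular
import Literature.MathematicalPhysics.QuantumFieldTheory.Balaban1983to89.B4Ineq120RegularRegion

/-!
# `Balaban1983to89.B4Ineq120TorusRegular` — [Balaban1983RegularityDecay] «Proposition 2.3 of [1]» (1.19)–(1.20) p. 574,
# `|δC^{(k)}_Λ(Ω,Ω₀,A; x,x′)| ≤ c₀e^{−δ₀(|x−x′| + dist(x,Ω^{(k)c}) + dist(x′,Ω^{(k)c}))}`, FOR NESTED REGIONS `Ω ⊂ Ω₀` OF THE
# DISCRETE TORUS at a (1.7)-regular torus field `A ≠ 0`, EVERY `Λ`, by the printed §5 route — with Corollary 2.3 and its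
# `δG` clause for the torus Green's functions taken from r01 g10's `cor23Printed_torusPairFam`

statement-level skeleton of published theorems with citation tags; proofs where landed; nothing here is a claim about the Yang–Mills mass gap

CITATION HEADER.  T. Bałaban, *Regularity and decay of lattice Green's functions*, Commun. Math. Phys. **89** (1983)
571–597, doi:10.1007/bf01214744 [Balaban1983RegularityDecay] (cell paper B4; held text
`paper:balaban1983-cmp89-regularity-decay`, journal page = PDF page + 570; pp. 572–574, 580–581, 593–594).  Cell
`pub-ymgap`, Track-A seat `pub-ymgap-dag-p3` gen 2 (node N01 of YM-PLAN §2; located flag F-torusU of row N01 — file 3 of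
the torus version of Prop. 2.3 on r01's carrier: file 1 `B4Ineq115TorusRegular` = (1.15), file 2 `B4Prop23TorusRegular` =
(1.16)–(1.18)).  Definitions with bodies (dictionary, no `Prop` fact): `gM0T`, `ham0T` (the ambient torus Green's function
compressed to `Ω` and its form matrix — torus twins of p17's `gM0`/`ham0`), `omegaT` (`dist_T(x, Ω^{(k)c})` on the unit
torus), `sdcT` (`dist_T(U, Ω^c)` for sets of fine sites); theorems otherwise; no `sorry`; axioms standard.  USED BY NAME:
r01's §5 route `B4Prop23Sect5Route.prop23_120_of_cor23` ((5.9) ⇒ (5.10) of the Sect. 5 Theorem inside), p17's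
`B4Ineq120RegularAmbient.{inclι, inclι_injective, sum_eq_sum_inclι, resV_mulVec_extV, dot_extV_mulVec_extV, fine_sub,
QkR_incl, QkR_incl_out, pOp_incl}` (verbatim at the periodic field), `B4Cor23RegionDeltaAlg.{extV, resV, extV_dotProduct,
extV_dotProduct_extV, extV_of_not_mem}`, r01 g9/g10's torus objects (`torusOp`, `TorusPairInst`, `torusPairFam`,
`cor23Printed_torusPairFam`, `tsupp`, `tssdist`, `tcdist`, `tbdistS`, `extT`, `resT`, `opXT_zero`, `opX₀T_zero`), and
files 1–2 of this seat.

WHAT IS PRINTED (verbatim).  p. 574: «Finally, for Ω ⊂ Ω₀ and δC^{(k)}_Λ(Ω, Ω₀, A) = C^{(k)}_Λ(Ω, A) − C^{(k)}_Λ(Ω₀, A),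
(1.19) we have |δC^{(k)}_Λ(Ω, Ω₀, A; x, x′)| ≤ c₀ exp(−δ₀(|x − x′| + dist(x, Ω^{(k)c}) + dist(x′, Ω^{(k)c}))), x, x′ ∈ Λ.
(1.20)»; p. 594: «a change of the domain Ω implies a change of the operator which can be estimated in the following way
|(Δ^{(k)}(Ω,A) − Δ^{(k)}(Ω₀,A))(x,x′)| ≦ c₀e^{−δ₀(|x−x′| + dist(x,Ω^{(k)c}) + dist(x′,Ω^{(k)c}))}, Ω ⊂ Ω₀, x, x′ ∈ Ω^{(k)}.
(5.5) From these properties it follows that Proposition I.2.3 is a consequence of the following Theorem.»; p. 581: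
«The same inequalities hold for δG_k(Ω,Ω₀,A) with the additional factor e^{−δ₀(dist(supp f,Ω^c) + dist(supp f′,Ω^c))}»;
p. 572: «Another common case is to consider operators on subsets of a torus T_η».

DICTIONARY (as files 1–2).  Nested torus regions `Ω^{(k)} = fineDom L Z_T ⊆ Ω₀^{(k)} = fineDom L Z₀_T` (`Z_T ⊆ Z₀_T ⊆
Π_ν[0,P′_ν)`, `L`-block labels) of the unit torus `Π_ν ℤ/(L·P′_ν)`, fine regions on the torus of fine period
`per n (per L P′)`, torus field `A` read periodically.  `C^{(k)}_Λ(Ω₀,A)` for `Λ ⊆ Ω^{(k)}` sees `G_k^T(Ω₀,A)` only through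
its compression `[G_k^T(Ω₀,A)]_{ΩΩ}` (`gM0T`), whose r01-form matrix is `ham0T` (`gk ham0T a_k Q_k = gM0T`); `dist(x, Ω^{(k)c})`
↦ `omegaT` = the torus sup-distance from the unit site to `T^{(k)}∖Ω^{(k)}` (`0` if `Ω^{(k)}` is the whole torus); in the
pairings, `dist(supp f, Ω^c)` ↦ `sdcT U` = the least `tcdist` (torus distance to `T_η∖Ω`, unit-lattice units) over the
sites of `U`.

WHAT THIS MODULE PROVES (all in full).
* §1 `gM0T`, `ham0T`, `kForm_ham0T`, `gM0T_transpose`, `ham0T_isSymm`, `gM0T_posDef`, `gk_ham0T` — the ambient torus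
  Green's function on `Ω`'s carriers (torus twins of p17's `B4Ineq120RegularAmbient` §2).
* §2 `deltaK_inclT` — `Δ^{(k)}_T(Ω₀,A)` RESTRICTED TO `Ω^{(k)}` is r01's `deltaK ham0T a_k Q_k`; `form115_lower_ambientT` —
  (5.3) for the restricted ambient operator from (5.3) on `Ω₀` (file 1's `form115_lower_torus`).
* §3 `omegaT`, `omegaT_nonneg`, `omegaT_lip`, `sdcT`, **`omegaT_le_sdcT`** (`dist_T(y, Ω^{(k)c}) ≤ dist_T(B^k(y), Ω^c) + 1`,
  torus block geometry via file 2's `tnorm_blk_le`); r01's and p17's extension ∕ restriction by zero agree (`extT_eq_extV`, private; restriction `rfl`).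
* §4 **`cor23_torus_setForm`** — from ONE invocation of r01 g10's `cor23Printed_torusPairFam` (block size `K = 1`): the
  three Corollary-2.3 inputs of r01's route in set form with COMMON constants `(c₀, δ₀, e₁)` — (5.4) for `G_k^T(Ω,A)`
  (instance `Ω = Ω₀`), (5.4) for `[G_k^T(Ω₀,A)]_{ΩΩ}` (instance `Ω₀ = Ω₀`, extensions by zero), and the `δG` clause (5.5)
  for `G_k^T(Ω,A) − [G_k^T(Ω₀,A)]_{ΩΩ}` (instance `Ω ⊂ Ω₀`, member `m = 0` of `dpair`) with the weights `dist_T(U, Ω^c)`.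
* §5 **`prop23_120_torus_unconditional`** — (1.19)–(1.20) ON THE TORUS AT A (1.7)-REGULAR TORUS FIELD, EVERY `Λ`, at
  the running coefficient `a_k = aSeq a L k`, explicit constants `cSt ∕ dSt (N·K_{d+1}) γ₀″(a_k) ((a_k²c₀ + a′L^{−2} +
  a_k)e^{3δ₀(L+1)}) δ₀` — r01's `prop23_120_of_cor23` fed by files 1–2 and §§1–4.
HONEST SCOPE.  The torus regions are unions of `L`-blocks of the unit torus (`L`-blocks and unit blocks do not wrap);
`n = L^k` and `a_k = aSeq a L k` are forced by r01 g10's family; `dist(x, Ω^{(k)c})` is the distance to the complement IN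
THE TORUS (print's reading; p17's lattice files read it inside `Ω₀`); constants are NOT uniform in `a_k` here (the window
bookkeeping is left to the family module).  No torus `UnitSetting` family is defined here (definitions module, review lane,
next).  Count-neutral for YM-PLAN (typed 28∕28 · discharged 0∕28 unmoved); nothing here concerns the continuum, ℝ⁴, OS
axioms, a mass gap or the Clay problem.
-/

namespace Literature.MathematicalPhysics.QuantumFieldTheory.Balaban1983to89.B4Ineq120TorusRegular

open Finset Matrix
open Literature.MathematicalPhysics.QuantumFieldTheory.Balaban1983to89
open Literature.MathematicalPhysics.QuantumFieldTheory.Balaban1983to89.B4GaugeCovariance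
open Literature.MathematicalPhysics.QuantumFieldTheory.Balaban1983to89.B4GaussRep36 (kForm gk pOp cLam)
open Literature.MathematicalPhysics.QuantumFieldTheory.Balaban1983to89.B4Sect5Torus (IsPseudoDist SumBound cSt dSt)
open Literature.MathematicalPhysics.QuantumFieldTheory.Balaban1983to89.B4ContourShift (supNorm supNorm_nonneg)
open Literature.MathematicalPhysics.QuantumFieldTheory.Balaban1983to89.B4Reflection242 (boxDom mem_boxDom blk blk_mem_boxDom)
open Literature.MathematicalPhysics.QuantumFieldTheory.Balaban1983to89.B4Lower18 (fineDom mem_fineDom)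
open Literature.MathematicalPhysics.QuantumFieldTheory.Balaban1983to89.B4Lower18Regular (e1)
open Literature.MathematicalPhysics.QuantumFieldTheory.Balaban1983to89.B4Lower18RegularRegion (rbaseEmb rbaseEmb_blk)
open Literature.MathematicalPhysics.QuantumFieldTheory.Balaban1983to89.B4RegionCubeCarrier (incl fineDom_mono)
open Literature.MathematicalPhysics.QuantumFieldTheory.Balaban1983to89.B4Cor23RegionDeltaAlg (extV resV extV_dotProduct
  extV_dotProduct_extV extV_of_not_mem)
open Literature.MathematicalPhysics.QuantumFieldTheory.Balaban1983to89.B4Cor23ZeroDelta (setDist setDist_le)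
open Literature.MathematicalPhysics.QuantumFieldTheory.Balaban1983to89.B4Cor23Region (bl2n)
open Literature.MathematicalPhysics.QuantumFieldTheory.Balaban1983to89.B4Cor23Rep36Bridge (QkR bl2n_sq)
open Literature.MathematicalPhysics.QuantumFieldTheory.Balaban1983to89.B4NextAvg52 (nextAvg rowOrtho_nextAvg)
open Literature.MathematicalPhysics.QuantumFieldTheory.Balaban1983to89.B4Prop23BlockAvg (abs_pOp_le_one)
open Literature.MathematicalPhysics.QuantumFieldTheory.Balaban1983to89.B4Prop23Sect5Route (prop23_120_of_cor23)
open Literature.MathematicalPhysics.QuantumFieldTheory.Balaban1983to89.B4Prop23RegularRegion (profK profK_nonneg suppK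
  QkR_row_support QkR_row_sq)
open Literature.MathematicalPhysics.QuantumFieldTheory.Balaban1983to89.B4Ineq53RegularRegion (gam0 gamLow gamLow_pos)
open Literature.MathematicalPhysics.QuantumFieldTheory.Balaban1983to89.B4Ineq120RegularAmbient (inclι inclι_injective
  sum_eq_sum_inclι resV_mulVec_extV dot_extV_mulVec_extV fine_sub QkR_incl QkR_incl_out pOp_incl)
open Literature.MathematicalPhysics.QuantumFieldTheory.Balaban1983to89.B4TorusRegionOp
open Literature.MathematicalPhysics.QuantumFieldTheory.Balaban1983to89.B4TorusPairFam (TorusPairInst torusPairFam tsupp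
  tssdist tcdist tbdistS tcdist_nonneg tbdistS_le eq_zero_of_not_mem_tsupp)
open Literature.MathematicalPhysics.QuantumFieldTheory.Balaban1983to89.B4Cor23TorusPairFam (cor23Printed_torusPairFam)
open Literature.MathematicalPhysics.QuantumFieldTheory.Balaban1983to89.B4Cor23TorusPairFam.Lift (opXT_zero opX₀T_zero)
open Literature.MathematicalPhysics.QuantumFieldTheory.Balaban1983to89.B4Ineq115TorusRegular (kForm_torus_eq gk_torus_eq
  form115_lower_torus fineDom_subset_perBox)
open Literature.MathematicalPhysics.QuantumFieldTheory.Balaban1983to89.B4Prop23TorusRegular (rhoT rhoT_isPseudoDist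
  rhoT_sumBound sdistT rhoT_le_sdistT rhoT_le_of_pOp_ne_zero hamT_isSymm tnorm_blk_le)
open Literature.MathematicalPhysics.QuantumFieldTheory.Balaban1983to89.B2Prop22RegularTorusPair (tnorm_add_le)

noncomputable section

variable {d : ℕ} {ι : Type} [Fintype ι] [DecidableEq ι]

/-! ## §1. `[G_k^T(Ω₀,A)]_{ΩΩ}` and its form matrix `H₀` on `Ω`'s carriers -/

section Ambient

variable (F : OrthFlow ι) (e : ℝ) {n L : ℕ} (hn : 1 ≤ n) (hL : 1 ≤ L) (a m2 : ℝ) (P' : Fin (d + 1) → ℕ)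
  {ZcT Z₀cT : Finset (Fin (d + 1) → ℤ)} (hsub : ZcT ⊆ Z₀cT) (Ac : (Fin (d + 1) → ℤ) → Fin (d + 1) → ℝ)

/-- **`[G_k^T(Ω₀,A)]_{ΩΩ}`**: the torus propagator (1.6) of `Ω₀` compressed to the fine points of `Ω` — the only part of
`G_k^T(Ω₀,A)` seen by `C^{(k)}_Λ(Ω₀,A)`, `Λ ⊆ Ω^{(k)}`. [cite: Balaban1983RegularityDecay, (1.6) p.572, (1.13)–(1.14) p.573, (1.19) p.574; p.572 (torus)] -/
def gM0T : Matrix (↥(fineDom n (fineDom L ZcT)) × ι) (↥(fineDom n (fineDom L ZcT)) × ι) ℝ :=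
  ((torusOp F e hn a m2 (per L P') (fineDom L Z₀cT) Ac)⁻¹).submatrix (inclι (fine_sub hn hL hsub))
    (inclι (fine_sub hn hL hsub))

/-- **`H₀ = ([G_k^T(Ω₀,A)]_{ΩΩ})^{−1} − a_kQ_kᵀQ_k`**, the form matrix on `Ω`'s fine points whose r01-propagator
`gk H₀ a_k Q_k` is `[G_k^T(Ω₀,A)]_{ΩΩ}` (`Q_k = Q_k(A^per)`). [cite: Balaban1983RegularityDecay, (1.14) p.573, (1.19) p.574, dictionary] -/
def ham0T : Matrix (↥(fineDom n (fineDom L ZcT)) × ι) (↥(fineDom n (fineDom L ZcT)) × ι) ℝ :=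
  (gM0T F e hn hL a m2 P' hsub Ac)⁻¹
    - a • ((QkR F e hn (fineDom L ZcT) (perField n (per L P') Ac))ᵀ * QkR F e hn (fineDom L ZcT) (perField n (per L P') Ac))

/-- `H₀ + a_kQ_kᵀQ_k = ([G_k^T(Ω₀,A)]_{ΩΩ})^{−1}`. [cite: Balaban1983RegularityDecay, (1.6) p.572, dictionary] -/
theorem kForm_ham0T :
    kForm (ham0T F e hn hL a m2 P' hsub Ac) a (QkR F e hn (fineDom L ZcT) (perField n (per L P') Ac))
      = (gM0T F e hn hL a m2 P' hsub Ac)⁻¹ := by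
  unfold kForm ham0T
  exact sub_add_cancel _ _

variable {a m2} (ha : 0 < a) (hm : 0 ≤ m2) (hZ₀ : Z₀cT ⊆ boxDom P')

include ha hm hZ₀ in
/-- `[G_k^T(Ω₀,A)]_{ΩΩ}` is symmetric (the torus operator is symmetric, positive definite for every `A`).
[cite: Balaban1983RegularityDecay, (1.6) p.572; p.572 (torus)] -/
theorem gM0T_transpose : (gM0T F e hn hL a m2 P' hsub Ac)ᵀ = gM0T F e hn hL a m2 P' hsub Ac := by
  have hT : (torusOp F e hn a m2 (per L P') (fineDom L Z₀cT) Ac).IsSymm :=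
    Matrix.isHermitian_iff_isSymm.1 (torusOp_posDef F hn (fineDom_subset_perBox hL Z₀cT hZ₀) e ha hm Ac).isHermitian
  unfold gM0T
  rw [Matrix.transpose_submatrix, Matrix.transpose_nonsing_inv, hT]

include ha hm hZ₀ in
/-- `H₀` is symmetric (r01's `hH₀`). [cite: Balaban1983RegularityDecay, (1.6) p.572, Sect. 5 Theorem p.594 «symmetric operator»] -/
theorem ham0T_isSymm : (ham0T F e hn hL a m2 P' hsub Ac).IsSymm := by
  unfold Matrix.IsSymm ham0T
  rw [Matrix.transpose_sub, Matrix.transpose_nonsing_inv, gM0T_transpose F e hn hL P' hsub Ac ha hm hZ₀,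
    Matrix.transpose_smul, Matrix.transpose_mul, Matrix.transpose_transpose]

include ha hm hZ₀ in
/-- `[G_k^T(Ω₀,A)]_{ΩΩ} > 0` (inverse and injective compression of a positive definite operator), for EVERY field.
[cite: Balaban1983RegularityDecay, (1.6) p.572, (1.8) p.573; p.572 (torus)] -/
theorem gM0T_posDef : (gM0T F e hn hL a m2 P' hsub Ac).PosDef := by
  unfold gM0T
  exact (torusOp_posDef F hn (fineDom_subset_perBox hL Z₀cT hZ₀) e ha hm Ac).inv.submatrix (inclι_injective _)

include ha hm hZ₀ in
/-- **`gk H₀ a_k Q_k = [G_k^T(Ω₀,A)]_{ΩΩ}`** (r01's propagator of the form matrix `H₀`). [cite: Balaban1983RegularityDecay, (1.6) p.572, (1.19) p.574, dictionary] -/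
theorem gk_ham0T :
    gk (ham0T F e hn hL a m2 P' hsub Ac) a (QkR F e hn (fineDom L ZcT) (perField n (per L P') Ac))
      = gM0T F e hn hL a m2 P' hsub Ac := by
  unfold gk
  rw [kForm_ham0T]
  exact Matrix.nonsing_inv_nonsing_inv _
    ((Matrix.isUnit_iff_isUnit_det _).mp (gM0T_posDef F e hn hL P' hsub Ac ha hm hZ₀).isUnit)

end Ambient

/-! ## §2. The ambient operator restricted to `Ω^{(k)}`; (5.3) for it -/

section Entries

variable (F : OrthFlow ι) (e : ℝ) {n L : ℕ} (hn : 1 ≤ n) (hL : 1 ≤ L) {a m2 : ℝ} (ha : 0 < a) (hm : 0 ≤ m2)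
  {P' : Fin (d + 1) → ℕ} {ZcT Z₀cT : Finset (Fin (d + 1) → ℤ)} (hsub : ZcT ⊆ Z₀cT) (hZ₀ : Z₀cT ⊆ boxDom P')
  (h3 : ∀ ν, 3 ≤ per n (per L P') ν) (Ac : (Fin (d + 1) → ℤ) → Fin (d + 1) → ℝ)

include ha hm hZ₀ h3 in
/-- **`Δ^{(k)}_T(Ω₀,A)` RESTRICTED TO `Ω^{(k)}` IS `a_kI − a_k²Q_k[G_k^T(Ω₀,A)]_{ΩΩ}Q_kᵀ`** = r01's `deltaK H₀ a_k Q_k` (the rows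
of `Q_k(A^per)` over `Ω^{(k)}` are the same for `Ω` and `Ω₀` and vanish on `Ω₀∖Ω` — p17's `QkR_incl`, `QkR_incl_out`).
[cite: Balaban1983RegularityDecay, (1.14) p.573, (1.19) p.574] -/
theorem deltaK_inclT (p q : ↥(fineDom L ZcT) × ι) :
    B4GaussRep36.deltaK (covLap (torWt n (per L P') (fineDom n (fineDom L Z₀cT)))
        (fieldLink F (e / n) fun u v : ↥(fineDom n (fineDom L Z₀cT)) => torBond n (per L P') Ac u.1 v.1)
        + m2 • (1 : Matrix _ _ ℝ)) a (QkR F e hn (fineDom L Z₀cT) (perField n (per L P') Ac))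
        (inclι (fineDom_mono hL hsub) p) (inclι (fineDom_mono hL hsub) q)
      = B4GaussRep36.deltaK (ham0T F e hn hL a m2 P' hsub Ac) a (QkR F e hn (fineDom L ZcT) (perField n (per L P') Ac))
          p q := by
  unfold B4GaussRep36.deltaK
  rw [gk_torus_eq F e hn h3 (fineDom_subset_perBox hL Z₀cT hZ₀) Ac a m2, gk_ham0T F e hn hL P' hsub Ac ha hm hZ₀]
  simp only [Matrix.sub_apply, Matrix.smul_apply, Matrix.one_apply, smul_eq_mul, (inclι_injective _).eq_iff]
  congr 2
  rw [Matrix.mul_apply, Matrix.mul_apply, sum_eq_sum_inclι (fine_sub hn hL hsub) _ fun P hP => by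
    rw [Matrix.transpose_apply, QkR_incl_out F e hn hL hsub (perField n (per L P') Ac) q P hP, mul_zero]]
  refine Finset.sum_congr rfl fun r' _ => ?_
  rw [Matrix.transpose_apply, Matrix.transpose_apply, QkR_incl F e hn hL hsub (perField n (per L P') Ac), Matrix.mul_apply,
    Matrix.mul_apply, sum_eq_sum_inclι (fine_sub hn hL hsub) _ fun P hP => by
      rw [QkR_incl_out F e hn hL hsub (perField n (per L P') Ac) p P hP, zero_mul]]
  congr 1
  exact Finset.sum_congr rfl fun r _ => by rw [QkR_incl F e hn hL hsub (perField n (per L P') Ac)]; rfl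

include ha hm hZ₀ h3 in
/-- **(5.3) FOR `[Δ^{(k)}_T(Ω₀,A) + a′L^{−2}P(A)]` RESTRICTED TO `Ω^{(k)}`** (r01's `hlow₀`): a lower bound (5.3) for the
operator of `Ω₀` on `Ω₀^{(k)}` descends to its restriction (test vectors extended by zero).
[cite: Balaban1983RegularityDecay, (5.3) p.593, (1.15) p.574] -/
theorem form115_lower_ambientT {γ s w : ℝ}
    (hlow₀ : ∀ φ : ↥(fineDom L Z₀cT) × ι → ℝ, γ * (φ ⬝ᵥ φ) ≤ φ ⬝ᵥ ((B4GaussRep36.deltaK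
      (covLap (torWt n (per L P') (fineDom n (fineDom L Z₀cT)))
        (fieldLink F (e / n) fun u v : ↥(fineDom n (fineDom L Z₀cT)) => torBond n (per L P') Ac u.1 v.1)
        + m2 • (1 : Matrix _ _ ℝ)) a (QkR F e hn (fineDom L Z₀cT) (perField n (per L P') Ac))
      + s • pOp w (nextAvg F (e / n) hL Z₀cT n (perField n (per L P') Ac))) *ᵥ φ))
    (v : ↥(fineDom L ZcT) × ι → ℝ) :
    γ * (v ⬝ᵥ v) ≤ v ⬝ᵥ ((B4GaussRep36.deltaK (ham0T F e hn hL a m2 P' hsub Ac) a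
        (QkR F e hn (fineDom L ZcT) (perField n (per L P') Ac))
      + s • pOp w (nextAvg F (e / n) hL ZcT n (perField n (per L P') Ac))) *ᵥ v) := by
  have hK : ∀ p q : ↥(fineDom L ZcT) × ι,
      (B4GaussRep36.deltaK (covLap (torWt n (per L P') (fineDom n (fineDom L Z₀cT)))
          (fieldLink F (e / n) fun u v : ↥(fineDom n (fineDom L Z₀cT)) => torBond n (per L P') Ac u.1 v.1)
          + m2 • (1 : Matrix _ _ ℝ)) a (QkR F e hn (fineDom L Z₀cT) (perField n (per L P') Ac))
        + s • pOp w (nextAvg F (e / n) hL Z₀cT n (perField n (per L P') Ac)))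
          (inclι (fineDom_mono hL hsub) p) (inclι (fineDom_mono hL hsub) q)
      = (B4GaussRep36.deltaK (ham0T F e hn hL a m2 P' hsub Ac) a (QkR F e hn (fineDom L ZcT) (perField n (per L P') Ac))
        + s • pOp w (nextAvg F (e / n) hL ZcT n (perField n (per L P') Ac))) p q := fun p q => by
    rw [Matrix.add_apply, Matrix.add_apply, Matrix.smul_apply, Matrix.smul_apply,
      deltaK_inclT F e hn hL ha hm hsub hZ₀ h3 Ac, pOp_incl F (e / n) hL hsub (perField n (per L P') Ac)]
  rw [← extV_dotProduct_extV (fineDom_mono hL hsub) v v, ← dot_extV_mulVec_extV (fineDom_mono hL hsub) _ _ hK v v]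
  exact hlow₀ _

end Entries

/-! ## §3. The boundary weight `dist_T(x, Ω^{(k)c})` on the unit torus, the torus complement distance of sets of fine
## sites, and the block geometry -/

/-- **`dist_T(y, Ω^{(k)c})`**: the torus sup-distance of the unit site of `y ∈ Y` to the complement `T^{(k)}∖Ω^{(k)}` of the
region in the unit torus (`0` when `Ω^{(k)}` is the whole torus). [cite: Balaban1983RegularityDecay, (1.20) p.574 «dist(x, Ω^{(k)c})»; p.572 (torus)] -/
def omegaT (L : ℕ) (P' : Fin (d + 1) → ℕ) (ZcT : Finset (Fin (d + 1) → ℤ)) (p : ↥(fineDom L ZcT) × ι) : ℝ :=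
  if h : (boxDom (per L P') \ fineDom L ZcT).Nonempty then
    (boxDom (per L P') \ fineDom L ZcT).inf' h (fun z => tnorm L P' (p.1.1 - z))
  else 0

/-- **`dist_T(U, Ω^c)`** for a set of fine sites × colours: the least torus distance (unit-lattice units) from a site of
`U` to the fine torus complement `T_η∖Ω` (`0` if `U` is empty; r01's `tcdist` per site). [cite: Balaban1983RegularityDecay, Cor. 2.3 p.581 «dist(supp f, Ω^c)», (5.5) p.594; p.572 (torus)] -/
def sdcT (n L : ℕ) (P' : Fin (d + 1) → ℕ) (ZcT : Finset (Fin (d + 1) → ℤ))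
    (U : Finset (↥(fineDom n (fineDom L ZcT)) × ι)) : ℝ :=
  if h : (U.image Prod.fst).Nonempty then (U.image Prod.fst).inf' h (fun r => tcdist (per L P') r) else 0

section Geometry

variable {n L : ℕ} (hn : 1 ≤ n) (hL : 1 ≤ L) {P' : Fin (d + 1) → ℕ} (hP' : ∀ ν, 1 ≤ P' ν)
  (ZcT : Finset (Fin (d + 1) → ℤ))

omit [Fintype ι] [DecidableEq ι] in
/-- `dist_T(y, Ω^{(k)c}) ≥ 0`. [cite: Balaban1983RegularityDecay, (1.20) p.574] -/
theorem omegaT_nonneg (p : ↥(fineDom L ZcT) × ι) : 0 ≤ omegaT L P' ZcT p := by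
  unfold omegaT
  split_ifs with h
  · exact Finset.le_inf' _ _ fun z _ => tnorm_nonneg _ _ _
  · exact le_rfl

omit [Fintype ι] [DecidableEq ι] in
include hL hP' in
/-- `dist_T(·, Ω^{(k)c})` is `1`-Lipschitz for the torus distance (r01's `hωρ`). [cite: Balaban1983RegularityDecay, (1.20) p.574] -/
theorem omegaT_lip (p q : ↥(fineDom L ZcT) × ι) : omegaT L P' ZcT p ≤ rhoT L P' ZcT p q + omegaT L P' ZcT q := by
  unfold omegaT rhoT
  split_ifs with h
  · obtain ⟨z, hz, hmin⟩ := Finset.exists_mem_eq_inf' h (fun z => tnorm L P' (q.1.1 - z))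
    rw [hmin]
    refine (Finset.inf'_le _ hz).trans ?_
    have ht := tnorm_add_le hL hP' (p.1.1 - q.1.1) (q.1.1 - z)
    rwa [sub_add_sub_cancel] at ht
  · rw [add_zero]; exact tnorm_nonneg _ _ _

omit [Fintype ι] [DecidableEq ι] in
/-- `dist_T(U, Ω^c) ≥ 0`. [cite: Balaban1983RegularityDecay, (5.5) p.594] -/
theorem sdcT_nonneg (U : Finset (↥(fineDom n (fineDom L ZcT)) × ι)) : 0 ≤ sdcT n L P' ZcT U := by
  unfold sdcT
  split_ifs with h
  · exact Finset.le_inf' _ _ fun r _ => tcdist_nonneg _ r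
  · exact le_rfl

omit [DecidableEq ι] in
include hn hL hP' in
/-- **`dist_T(y, Ω^{(k)c}) ≤ dist_T(B^k(y)×ι, Ω^c) + 1`** (r01's `hωS` on the torus): a fine point outside `Ω` lies in a unit
block outside `Ω^{(k)}`, and the unit torus distance of the blocks is at most the fine torus distance `+ 1` (file 2's
`tnorm_blk_le`). [cite: Balaban1983RegularityDecay, (1.20) p.574, (5.5) p.594] -/
theorem omegaT_le_sdcT (p : ↥(fineDom L ZcT) × ι) :
    omegaT L P' ZcT p ≤ sdcT n L P' ZcT (suppK ZcT hn p) + 1 := by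
  have hsdc0 := sdcT_nonneg (P' := P') ZcT (suppK (ι := ι) ZcT hn p)
  -- the row support is non-empty (the base corner of the block)
  have hmem : (rbaseEmb hn (fineDom L ZcT) p.1) ∈ (suppK ZcT hn p).image Prod.fst :=
    Finset.mem_image.2 ⟨(rbaseEmb hn (fineDom L ZcT) p.1, p.2),
      Finset.mem_filter.2 ⟨Finset.mem_univ _, Subtype.ext (rbaseEmb_blk hn (fineDom L ZcT) p.1)⟩, rfl⟩
  have hne : ((suppK (ι := ι) ZcT hn p).image Prod.fst).Nonempty := ⟨_, hmem⟩
  obtain ⟨r, hr, hmin⟩ := Finset.exists_mem_eq_inf' hne (fun r => tcdist (per L P') r)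
  have hsdc : sdcT n L P' ZcT (suppK ZcT hn p) = tcdist (per L P') r := by
    unfold sdcT; rw [dif_pos hne]; exact hmin
  obtain ⟨r', hr', rfl⟩ := Finset.mem_image.1 hr
  have hrb : blk n r'.1.1 = p.1.1 := congrArg Subtype.val (Finset.mem_filter.1 hr').2
  -- the fine torus complement of `Ω`
  by_cases hE : (boxDom (per n (per L P')) \ fineDom n (fineDom L ZcT)).Nonempty
  · obtain ⟨z, hz, hzmin⟩ := Finset.exists_mem_eq_inf' hE (fun z => tnorm n (per L P') (r'.1.1 - z) / (n : ℝ))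
    have htc : tcdist (per L P') r'.1 = tnorm n (per L P') (r'.1.1 - z) / (n : ℝ) := by
      unfold tcdist; rw [dif_pos hE]; exact hzmin
    obtain ⟨hz₀, hz₁⟩ := Finset.mem_sdiff.1 hz
    -- the unit block of `z` lies in the unit torus complement of `Ω^{(k)}`
    have hbz : blk n z ∈ boxDom (per L P') \ fineDom L ZcT := by
      refine Finset.mem_sdiff.2 ⟨?_, fun hc => hz₁ ((mem_fineDom hn).2 hc)⟩
      have hz₀' : z ∈ boxDom (fun i => n * per L P' i) := hz₀
      exact blk_mem_boxDom hn hz₀'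
    have hω : omegaT L P' ZcT p ≤ tnorm L P' (p.1.1 - blk n z) := by
      unfold omegaT
      rw [dif_pos ⟨_, hbz⟩]
      exact Finset.inf'_le _ hbz
    have hb := tnorm_blk_le hn hL hP' r'.1.1 z
    rw [hrb] at hb
    rw [hsdc, htc]
    linarith
  · -- no fine point outside `Ω`: then no unit label outside `Ω^{(k)}` either, and `ω = 0`
    have hE' : ¬ (boxDom (per L P') \ fineDom L ZcT).Nonempty := by
      rintro ⟨y, hy⟩
      obtain ⟨hy₀, hy₁⟩ := Finset.mem_sdiff.1 hy
      refine hE ⟨fun i => (n : ℤ) * y i, Finset.mem_sdiff.2 ⟨?_, fun hc => hy₁ ?_⟩⟩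
      · rw [mem_boxDom] at hy₀ ⊢
        intro i
        have hn0 : (0 : ℤ) < n := by exact_mod_cast hn
        obtain ⟨h0, h1⟩ := hy₀ i
        refine ⟨mul_nonneg hn0.le h0, ?_⟩
        have : (n : ℤ) * y i < (n : ℤ) * (per L P' i : ℤ) := mul_lt_mul_of_pos_left h1 hn0
        simpa [per, Nat.cast_mul, mul_assoc] using this
      · rw [mem_fineDom hn, B4Reflection242.blk_mul hn] at hc
        exact hc
    unfold omegaT
    rw [dif_neg hE']
    linarith

end Geometry

/-! ## §4. The three Corollary-2.3 inputs of r01's route in set form, with COMMON constants, from ONE invocation of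
## r01 g10's `cor23Printed_torusPairFam` (block size `K = 1`) -/

section SetForm

variable {ℓ : ℕ} {amin aplus m2plus creg β : ℝ} (F : OrthFlow ι) (i : TorusPairInst d ℓ amin aplus m2plus)

omit [DecidableEq ι] in
/-- the `ℓ²` norm of r01's torus family is b04's `bl2n`. [cite: Balaban1983RegularityDecay, Cor. 2.3 (2.30) p.580 «‖f‖₂», dictionary] -/
private theorem sqrt_sum_sq_eq_bl2n {J : Type} [Fintype J] (g : J → ℝ) : Real.sqrt (∑ q, g q ^ 2) = bl2n g := by
  unfold bl2n dotProduct
  congr 1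
  exact Finset.sum_congr rfl fun q _ => sq (g q)

omit [Fintype ι] [DecidableEq ι] in
/-- every region is a union of `1`-blocks. [cite: Balaban1983RegularityDecay, p.572 «unions of big blocks», dictionary (trivial block size)] -/
private theorem isBlockUnion_one (R : Finset (Fin (d + 1) → ℤ)) : B4Lower18.IsBlockUnion 1 R := by
  intro x hx z hz
  have h1 : ∀ w : Fin (d + 1) → ℤ, blk 1 w = w := fun w => by funext j; simp [blk]
  rw [h1, h1] at hz
  rw [hz]; exact hx

omit [DecidableEq ι] in
/-- a site in the support of a source vanishing off `V` projects from `V`. [cite: Balaban1983RegularityDecay, Cor. 2.3 p.581 «supp f», dictionary] -/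
private theorem mem_image_of_mem_tsupp {n : ℕ} {ΩT : Finset (Fin (d + 1) → ℤ)} (f : ↥(fineDom n ΩT) × ι → ℝ)
    (V : Finset (↥(fineDom n ΩT) × ι)) (hf : ∀ x ∉ V, f x = 0) (z : ↥(fineDom n ΩT)) (hz : z ∈ tsupp f) :
    z ∈ V.image Prod.fst := by
  have hz' : ∃ j, f (z, j) ≠ 0 := by
    unfold tsupp at hz
    exact (Finset.mem_filter.1 hz).2
  obtain ⟨j, hj⟩ := hz'
  have hzV : (z, j) ∈ V := by
    by_contra hc
    exact hj (hf _ hc)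
  exact Finset.mem_image.2 ⟨(z, j), hzV, rfl⟩

/-- **the member `m = 0` of (2.30) in set form**: from `|⟨g, G g′⟩| ≤ c₀e^{−δ₀dist_T(supp g, supp g′)}‖g‖₂‖g′‖₂` to the same
with `dist_T(U, U′)` for `g, g′` vanishing off `U, U′`. [cite: Balaban1983RegularityDecay, Cor. 2.3 (2.30) pp.580–581; (5.4) p.593] -/
private theorem pair_setForm {c₀ δ₀ : ℝ} (hc₀ : 0 < c₀) (hδ₀ : 0 < δ₀)
    (g g' : ↥(fineDom ((ℓ + 1) ^ i.k) i.ΩT) × ι → ℝ) (U U' : Finset (↥(fineDom ((ℓ + 1) ^ i.k) i.ΩT) × ι))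
    (hg : ∀ x ∉ U, g x = 0) (hg' : ∀ x ∉ U', g' x = 0)
    (hm : |g ⬝ᵥ (i.GT F *ᵥ g')| ≤ c₀ * Real.exp (-(δ₀ * tssdist i.P g g')) * Real.sqrt (∑ q, g q ^ 2)
      * Real.sqrt (∑ q, g' q ^ 2)) :
    |g ⬝ᵥ (i.GT F *ᵥ g')| ≤ c₀ * bl2n g * bl2n g' * Real.exp (-(δ₀ *
      setDist (fun r w : ↥(fineDom ((ℓ + 1) ^ i.k) i.ΩT) => tnorm ((ℓ + 1) ^ i.k) i.P (r.1 - w.1) / (((ℓ + 1) ^ i.k : ℕ) : ℝ))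
        (U.image Prod.fst) (U'.image Prod.fst))) := by
  classical
  rw [sqrt_sum_sq_eq_bl2n, sqrt_sum_sq_eq_bl2n] at hm
  set D : ℝ := setDist (fun r w : ↥(fineDom ((ℓ + 1) ^ i.k) i.ΩT) =>
      tnorm ((ℓ + 1) ^ i.k) i.P (r.1 - w.1) / (((ℓ + 1) ^ i.k : ℕ) : ℝ)) (U.image Prod.fst) (U'.image Prod.fst) with hD
  have h1 : 0 ≤ bl2n g := Real.sqrt_nonneg _
  have h2 : 0 ≤ bl2n g' := Real.sqrt_nonneg _
  have hRHS : 0 ≤ c₀ * bl2n g * bl2n g' * Real.exp (-(δ₀ * D)) := by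
    have := hc₀.le; have := (Real.exp_pos (-(δ₀ * D))).le; positivity
  by_cases hne : (tsupp g ×ˢ tsupp g').Nonempty
  · obtain ⟨q, hq, hmin⟩ := Finset.exists_mem_eq_inf' hne
      (fun p : ↥(fineDom ((ℓ + 1) ^ i.k) i.ΩT) × ↥(fineDom ((ℓ + 1) ^ i.k) i.ΩT) =>
        tnorm ((ℓ + 1) ^ i.k) i.P (p.1.1 - p.2.1) / (((ℓ + 1) ^ i.k : ℕ) : ℝ))
    have hts : tssdist i.P g g' = tnorm ((ℓ + 1) ^ i.k) i.P (q.1.1 - q.2.1) / (((ℓ + 1) ^ i.k : ℕ) : ℝ) := by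
      unfold tssdist
      rw [dif_pos hne]
      exact hmin
    obtain ⟨hq1, hq2⟩ := Finset.mem_product.1 hq
    have hsd : D ≤ tssdist i.P g g' := by
      rw [hts, hD]
      exact setDist_le _ (mem_image_of_mem_tsupp g U hg q.1 hq1) (mem_image_of_mem_tsupp g' U' hg' q.2 hq2)
    calc |g ⬝ᵥ (i.GT F *ᵥ g')| ≤ c₀ * Real.exp (-(δ₀ * tssdist i.P g g')) * bl2n g * bl2n g' := hm
      _ ≤ c₀ * Real.exp (-(δ₀ * D)) * bl2n g * bl2n g' := by
          have hexp : Real.exp (-(δ₀ * tssdist i.P g g')) ≤ Real.exp (-(δ₀ * D)) :=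
            Real.exp_le_exp.2 (neg_le_neg (mul_le_mul_of_nonneg_left hsd hδ₀.le))
          exact mul_le_mul_of_nonneg_right (mul_le_mul_of_nonneg_right
            (mul_le_mul_of_nonneg_left hexp hc₀.le) h1) h2
      _ = c₀ * bl2n g * bl2n g' * Real.exp (-(δ₀ * D)) := by ring
  · rw [Finset.not_nonempty_iff_eq_empty, Finset.product_eq_empty] at hne
    have h0 : g ⬝ᵥ (i.GT F *ᵥ g') = 0 := by
      rcases hne with h | h
      · have hg0 : g = 0 := funext fun p => eq_zero_of_not_mem_tsupp g p (by rw [h]; exact Finset.notMem_empty _)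
        rw [hg0, zero_dotProduct]
      · have hg0 : g' = 0 := funext fun p => eq_zero_of_not_mem_tsupp g' p (by rw [h]; exact Finset.notMem_empty _)
        rw [hg0, Matrix.mulVec_zero, dotProduct_zero]
    rw [h0, abs_zero]
    exact hRHS

/-- **the member `m = 0` of the `δG` clause of Corollary 2.3 in set form**: from the weights `dist_T(supp g, supp g′)` and
`dist_T(supp g, Ω^c) + dist_T(supp g′, Ω^c)` to `dist_T(U,U′) + dist_T(U,Ω^c) + dist_T(U′,Ω^c)` for `g, g′` vanishing off
`U, U′`. [cite: Balaban1983RegularityDecay, Cor. 2.3 p.581 (δG clause); (5.5) p.594] -/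
private theorem dpair_setForm {c₀ δ₀ : ℝ} (hc₀ : 0 < c₀) (hδ₀ : 0 < δ₀)
    (g g' : ↥(fineDom ((ℓ + 1) ^ i.k) i.ΩT) × ι → ℝ) (U U' : Finset (↥(fineDom ((ℓ + 1) ^ i.k) i.ΩT) × ι))
    (hg : ∀ x ∉ U, g x = 0) (hg' : ∀ x ∉ U', g' x = 0)
    (hm : |g ⬝ᵥ (i.GT F *ᵥ g' - i.resT (i.G₀T F *ᵥ i.extT g'))|
      ≤ c₀ * Real.exp (-(δ₀ * tssdist i.P g g')) * Real.exp (-(δ₀ * (tbdistS i.P g + tbdistS i.P g')))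
        * Real.sqrt (∑ q, g q ^ 2) * Real.sqrt (∑ q, g' q ^ 2)) :
    |g ⬝ᵥ (i.GT F *ᵥ g' - i.resT (i.G₀T F *ᵥ i.extT g'))| ≤ c₀ * bl2n g * bl2n g' * Real.exp (-(δ₀ *
      (setDist (fun r w : ↥(fineDom ((ℓ + 1) ^ i.k) i.ΩT) => tnorm ((ℓ + 1) ^ i.k) i.P (r.1 - w.1) / (((ℓ + 1) ^ i.k : ℕ) : ℝ))
          (U.image Prod.fst) (U'.image Prod.fst)
        + (if h : (U.image Prod.fst).Nonempty then (U.image Prod.fst).inf' h (fun r => tcdist i.P r) else 0)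
        + (if h : (U'.image Prod.fst).Nonempty then (U'.image Prod.fst).inf' h (fun r => tcdist i.P r) else 0)))) := by
  classical
  rw [sqrt_sum_sq_eq_bl2n, sqrt_sum_sq_eq_bl2n] at hm
  set D : ℝ := setDist (fun r w : ↥(fineDom ((ℓ + 1) ^ i.k) i.ΩT) =>
      tnorm ((ℓ + 1) ^ i.k) i.P (r.1 - w.1) / (((ℓ + 1) ^ i.k : ℕ) : ℝ)) (U.image Prod.fst) (U'.image Prod.fst) with hD
  set B : ℝ := (if h : (U.image Prod.fst).Nonempty then (U.image Prod.fst).inf' h (fun r => tcdist i.P r) else 0) with hB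
  set B' : ℝ := (if h : (U'.image Prod.fst).Nonempty then (U'.image Prod.fst).inf' h (fun r => tcdist i.P r) else 0)
    with hB'
  have h1 : 0 ≤ bl2n g := Real.sqrt_nonneg _
  have h2 : 0 ≤ bl2n g' := Real.sqrt_nonneg _
  have hRHS : 0 ≤ c₀ * bl2n g * bl2n g' * Real.exp (-(δ₀ * (D + B + B'))) := by
    have := hc₀.le; have := (Real.exp_pos (-(δ₀ * (D + B + B')))).le; positivity
  by_cases hne : (tsupp g ×ˢ tsupp g').Nonempty
  · obtain ⟨hneg, hneg'⟩ := Finset.nonempty_product.1 hne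
    -- `D ≤ dist_T(supp g, supp g′)`
    obtain ⟨q, hq, hmin⟩ := Finset.exists_mem_eq_inf' hne
      (fun p : ↥(fineDom ((ℓ + 1) ^ i.k) i.ΩT) × ↥(fineDom ((ℓ + 1) ^ i.k) i.ΩT) =>
        tnorm ((ℓ + 1) ^ i.k) i.P (p.1.1 - p.2.1) / (((ℓ + 1) ^ i.k : ℕ) : ℝ))
    have hts : tssdist i.P g g' = tnorm ((ℓ + 1) ^ i.k) i.P (q.1.1 - q.2.1) / (((ℓ + 1) ^ i.k : ℕ) : ℝ) := by
      unfold tssdist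
      rw [dif_pos hne]
      exact hmin
    obtain ⟨hq1, hq2⟩ := Finset.mem_product.1 hq
    have hsd : D ≤ tssdist i.P g g' := by
      rw [hts, hD]
      exact setDist_le _ (mem_image_of_mem_tsupp g U hg q.1 hq1) (mem_image_of_mem_tsupp g' U' hg' q.2 hq2)
    -- `B ≤ dist_T(supp g, Ω^c)` and `B′ ≤ dist_T(supp g′, Ω^c)`
    have hbd : ∀ {f : ↥(fineDom ((ℓ + 1) ^ i.k) i.ΩT) × ι → ℝ} {V : Finset (↥(fineDom ((ℓ + 1) ^ i.k) i.ΩT) × ι)},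
        (∀ x ∉ V, f x = 0) → (tsupp f).Nonempty →
        (if h : (V.image Prod.fst).Nonempty then (V.image Prod.fst).inf' h (fun r => tcdist i.P r) else 0)
          ≤ tbdistS i.P f := by
      intro f V hf hfs
      obtain ⟨z, hz, hzmin⟩ := Finset.exists_mem_eq_inf' hfs (fun z => tcdist i.P z)
      have htb : tbdistS i.P f = tcdist i.P z := by unfold tbdistS; rw [dif_pos hfs]; exact hzmin
      have hzV := mem_image_of_mem_tsupp f V hf z hz
      rw [dif_pos ⟨z, hzV⟩, htb]
      exact Finset.inf'_le _ hzV
    have hB1 : B ≤ tbdistS i.P g := by rw [hB]; exact hbd hg hneg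
    have hB2 : B' ≤ tbdistS i.P g' := by rw [hB']; exact hbd hg' hneg'
    have hexp : Real.exp (-(δ₀ * tssdist i.P g g')) * Real.exp (-(δ₀ * (tbdistS i.P g + tbdistS i.P g')))
        ≤ Real.exp (-(δ₀ * (D + B + B'))) := by
      rw [← Real.exp_add]
      exact Real.exp_le_exp.2 (by nlinarith [hδ₀.le])
    calc |g ⬝ᵥ (i.GT F *ᵥ g' - i.resT (i.G₀T F *ᵥ i.extT g'))|
        ≤ c₀ * Real.exp (-(δ₀ * tssdist i.P g g')) * Real.exp (-(δ₀ * (tbdistS i.P g + tbdistS i.P g')))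
          * bl2n g * bl2n g' := hm
      _ = c₀ * (Real.exp (-(δ₀ * tssdist i.P g g')) * Real.exp (-(δ₀ * (tbdistS i.P g + tbdistS i.P g'))))
          * bl2n g * bl2n g' := by ring
      _ ≤ c₀ * Real.exp (-(δ₀ * (D + B + B'))) * bl2n g * bl2n g' :=
          mul_le_mul_of_nonneg_right (mul_le_mul_of_nonneg_right (mul_le_mul_of_nonneg_left hexp hc₀.le) h1) h2
      _ = c₀ * bl2n g * bl2n g' * Real.exp (-(δ₀ * (D + B + B'))) := by ring
  · rw [Finset.not_nonempty_iff_eq_empty, Finset.product_eq_empty] at hne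
    have h0 : g ⬝ᵥ (i.GT F *ᵥ g' - i.resT (i.G₀T F *ᵥ i.extT g')) = 0 := by
      rcases hne with h | h
      · have hg0 : g = 0 := funext fun p => eq_zero_of_not_mem_tsupp g p (by rw [h]; exact Finset.notMem_empty _)
        rw [hg0, zero_dotProduct]
      · have hg0 : g' = 0 := funext fun p => eq_zero_of_not_mem_tsupp g' p (by rw [h]; exact Finset.notMem_empty _)
        have hext : i.extT (0 : ↥(fineDom ((ℓ + 1) ^ i.k) i.ΩT) × ι → ℝ) = 0 := by
          funext p
          unfold TorusPairInst.extT
          split_ifs <;> rfl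
        rw [hg0, hext, Matrix.mulVec_zero, Matrix.mulVec_zero]
        have hres : i.resT (0 : ↥(fineDom ((ℓ + 1) ^ i.k) i.Ω₀T) × ι → ℝ) = 0 := rfl
        rw [hres, sub_zero, dotProduct_zero]
    rw [h0, abs_zero]
    exact hRHS

end SetForm

section Cor23

variable (F : OrthFlow ι) {ℓ₁ : ℝ} (hℓ₁ : 0 ≤ ℓ₁)
  (hLip : ∀ t (v : ι → ℝ), ((F.U t - 1) *ᵥ v) ⬝ᵥ ((F.U t - 1) *ᵥ v) ≤ (ℓ₁ * t) ^ 2 * (v ⬝ᵥ v))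

omit [Fintype ι] [DecidableEq ι] in
/-- r01's extension by zero to `Ω₀` is p17's. [cite: Balaban1983RegularityDecay, (1.11) p.573, dictionary] -/
private theorem extT_eq_extV {ℓ : ℕ} {amin aplus m2plus : ℝ} (i : TorusPairInst d ℓ amin aplus m2plus)
    (f : ↥(fineDom ((ℓ + 1) ^ i.k) i.ΩT) × ι → ℝ) :
    i.extT f = extV (fineDom ((ℓ + 1) ^ i.k) i.Ω₀T) f := by
  funext p
  unfold TorusPairInst.extT extV
  by_cases h : blk ((ℓ + 1) ^ i.k) p.1.1 ∈ i.ΩT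
  · have h' : p.1.1 ∈ fineDom ((ℓ + 1) ^ i.k) i.ΩT := (mem_fineDom (Nat.one_le_pow i.k (ℓ + 1) (Nat.succ_pos ℓ))).2 h
    rw [dif_pos h, dif_pos h']
  · have h' : p.1.1 ∉ fineDom ((ℓ + 1) ^ i.k) i.ΩT := fun hc =>
      h ((mem_fineDom (Nat.one_le_pow i.k (ℓ + 1) (Nat.succ_pos ℓ))).1 hc)
    rw [dif_neg h, dif_neg h']

include hℓ₁ hLip in
/-- **THE THREE COROLLARY-2.3 INPUTS OF r01's §5 ROUTE ON THE TORUS, SET FORM, COMMON CONSTANTS** — from ONE invocation of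
r01 g10's `cor23Printed_torusPairFam` at block size `K = 1`: there are `c₀, δ₀, e₁ > 0` such that at every scale `k ≥ 1`
(`n = L^k`, `a_k = aSeq a L k`), on every unit torus and every NESTED pair `Ω^{(k)} ⊆ Ω₀^{(k)}` of unions of its `L`-blocks,
for every torus field with (1.7) on `Ω₀` and `0 < e ≤ e₁`, and all `g, g′` on `Ω` supported in `U, U′`:
(5.4) for `G_k^T(Ω,A)` (instance `Ω = Ω₀ := Ω`), (5.4) for `[G_k^T(Ω₀,A)]_{ΩΩ}` (instance `Ω = Ω₀ := Ω₀`, sources extended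
by zero), and (5.5) for `G_k^T(Ω,A) − [G_k^T(Ω₀,A)]_{ΩΩ}` (the `δG` clause at the instance `Ω ⊂ Ω₀`) with the extra weight
`dist_T(U,Ω^c) + dist_T(U′,Ω^c)`. [cite: Balaban1983RegularityDecay, Cor. 2.3 (2.30) pp.580–581 incl. the δG clause; (5.4)–(5.5) pp.593–594; p.572 (torus)] -/
theorem cor23_torus_setForm (ℓ : ℕ) (hℓ : 1 ≤ ℓ) (amin aplus m2plus : ℝ) (ha : 0 < amin) (creg β : ℝ)
    (hcreg : 0 ≤ creg) (hβ : 0 < β) :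
    ∃ c₀ δ₀ e₁ : ℝ, 0 < c₀ ∧ 0 < δ₀ ∧ 0 < e₁ ∧
      ∀ (k : ℕ) (hk : 1 ≤ k) (P' : Fin (d + 1) → ℕ) (hP' : ∀ ν, 1 ≤ P' ν) (ZcT Z₀cT : Finset (Fin (d + 1) → ℤ))
        (hsub : ZcT ⊆ Z₀cT) (hZ₀ : Z₀cT ⊆ boxDom P') (h3 : ∀ ν, 3 ≤ per ((ℓ + 1) ^ k) (per (ℓ + 1) P') ν)
        (a₀ m2 : ℝ), amin ≤ a₀ → a₀ ≤ aplus → 0 ≤ m2 → m2 ≤ m2plus →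
        ∀ (Ac : (Fin (d + 1) → ℤ) → Fin (d + 1) → ℝ) (e : ℝ),
        (∀ x ∈ fineDom ((ℓ + 1) ^ k) (fineDom (ℓ + 1) Z₀cT), ∀ μ ν : Fin (d + 1),
          |Ac (twrap ((ℓ + 1) ^ k) (per (ℓ + 1) P') (x + e1 μ)) ν - Ac x ν| ≤ creg * e ^ (β - 1) / ((ℓ + 1) ^ k : ℕ)) →
        0 < e → e ≤ e₁ →
        (∀ (g g' : ↥(fineDom ((ℓ + 1) ^ k) (fineDom (ℓ + 1) ZcT)) × ι → ℝ)
            (U U' : Finset (↥(fineDom ((ℓ + 1) ^ k) (fineDom (ℓ + 1) ZcT)) × ι)),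
            (∀ x ∉ U, g x = 0) → (∀ x ∉ U', g' x = 0) →
            |g ⬝ᵥ ((torusOp F e (Nat.one_le_pow k (ℓ + 1) (Nat.succ_pos ℓ)) (B1.aSeq a₀ ((ℓ : ℝ) + 1) k) m2
                (per (ℓ + 1) P') (fineDom (ℓ + 1) ZcT) Ac)⁻¹ *ᵥ g')|
              ≤ c₀ * bl2n g * bl2n g' * Real.exp (-(δ₀ * sdistT ((ℓ + 1) ^ k) (ℓ + 1) P' ZcT U U'))) ∧
        (∀ (g g' : ↥(fineDom ((ℓ + 1) ^ k) (fineDom (ℓ + 1) ZcT)) × ι → ℝ)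
            (U U' : Finset (↥(fineDom ((ℓ + 1) ^ k) (fineDom (ℓ + 1) ZcT)) × ι)),
            (∀ x ∉ U, g x = 0) → (∀ x ∉ U', g' x = 0) →
            |g ⬝ᵥ (gM0T F e (Nat.one_le_pow k (ℓ + 1) (Nat.succ_pos ℓ)) (Nat.succ_le_succ (Nat.zero_le ℓ))
                (B1.aSeq a₀ ((ℓ : ℝ) + 1) k) m2 P' hsub Ac *ᵥ g')|
              ≤ c₀ * bl2n g * bl2n g' * Real.exp (-(δ₀ * sdistT ((ℓ + 1) ^ k) (ℓ + 1) P' ZcT U U'))) ∧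
        (∀ (g g' : ↥(fineDom ((ℓ + 1) ^ k) (fineDom (ℓ + 1) ZcT)) × ι → ℝ)
            (U U' : Finset (↥(fineDom ((ℓ + 1) ^ k) (fineDom (ℓ + 1) ZcT)) × ι)),
            (∀ x ∉ U, g x = 0) → (∀ x ∉ U', g' x = 0) →
            |g ⬝ᵥ (((torusOp F e (Nat.one_le_pow k (ℓ + 1) (Nat.succ_pos ℓ)) (B1.aSeq a₀ ((ℓ : ℝ) + 1) k) m2
                (per (ℓ + 1) P') (fineDom (ℓ + 1) ZcT) Ac)⁻¹
                - gM0T F e (Nat.one_le_pow k (ℓ + 1) (Nat.succ_pos ℓ)) (Nat.succ_le_succ (Nat.zero_le ℓ))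
                  (B1.aSeq a₀ ((ℓ : ℝ) + 1) k) m2 P' hsub Ac) *ᵥ g')|
              ≤ c₀ * bl2n g * bl2n g' * Real.exp (-(δ₀ * (sdistT ((ℓ + 1) ^ k) (ℓ + 1) P' ZcT U U'
                  + sdcT ((ℓ + 1) ^ k) (ℓ + 1) P' ZcT U + sdcT ((ℓ + 1) ^ k) (ℓ + 1) P' ZcT U')))) := by
  classical
  obtain ⟨c₀, δ₀, e₁, hc₀, hδ₀, he₁, H⟩ :=
    cor23Printed_torusPairFam F hℓ₁ hLip d ℓ hℓ amin aplus m2plus ha creg β hcreg hβ 1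
  refine ⟨c₀, δ₀, e₁, hc₀, hδ₀, he₁, ?_⟩
  intro k hk P' hP' ZcT Z₀cT hsub hZ₀ h3 a₀ m2 ha1 ha2 hm1 hm2 Ac e hreg he hle
  have hL1 : 1 ≤ ℓ + 1 := Nat.succ_le_succ (Nat.zero_le ℓ)
  have hn1 : 1 ≤ (ℓ + 1) ^ k := Nat.one_le_pow k (ℓ + 1) (Nat.succ_pos ℓ)
  have hZ : ZcT ⊆ boxDom P' := hsub.trans hZ₀
  have hXX : fineDom ((ℓ + 1) ^ k) (fineDom (ℓ + 1) ZcT) ⊆ fineDom ((ℓ + 1) ^ k) (fineDom (ℓ + 1) Z₀cT) :=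
    fine_sub hn1 hL1 hsub
  have hregΩ : ∀ x ∈ fineDom ((ℓ + 1) ^ k) (fineDom (ℓ + 1) ZcT), ∀ μ ν : Fin (d + 1),
      |Ac (twrap ((ℓ + 1) ^ k) (per (ℓ + 1) P') (x + e1 μ)) ν - Ac x ν| ≤ creg * e ^ (β - 1) / ((ℓ + 1) ^ k : ℕ) :=
    fun x hx => hreg x (hXX hx)
  -- the three instances
  let iΩ : TorusPairInst d ℓ amin aplus m2plus :=
    { k := k, hk := hk, P := per (ℓ + 1) P', hP := per_pos hL1 hP', h3 := h3,
      Ω₀T := fineDom (ℓ + 1) ZcT, ΩT := fineDom (ℓ + 1) ZcT, hbox := fineDom_subset_perBox hL1 ZcT hZ,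
      hsub := Finset.Subset.refl _, a := a₀, m2 := m2, ha1 := ha1, ha2 := ha2, hm1 := hm1, hm2 := hm2, Ac := Ac, e := e }
  let i₀ : TorusPairInst d ℓ amin aplus m2plus :=
    { k := k, hk := hk, P := per (ℓ + 1) P', hP := per_pos hL1 hP', h3 := h3,
      Ω₀T := fineDom (ℓ + 1) Z₀cT, ΩT := fineDom (ℓ + 1) Z₀cT, hbox := fineDom_subset_perBox hL1 Z₀cT hZ₀,
      hsub := Finset.Subset.refl _, a := a₀, m2 := m2, ha1 := ha1, ha2 := ha2, hm1 := hm1, hm2 := hm2, Ac := Ac, e := e }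
  let j : TorusPairInst d ℓ amin aplus m2plus :=
    { k := k, hk := hk, P := per (ℓ + 1) P', hP := per_pos hL1 hP', h3 := h3,
      Ω₀T := fineDom (ℓ + 1) Z₀cT, ΩT := fineDom (ℓ + 1) ZcT, hbox := fineDom_subset_perBox hL1 Z₀cT hZ₀,
      hsub := fineDom_mono hL1 hsub, a := a₀, m2 := m2, ha1 := ha1, ha2 := ha2, hm1 := hm1, hm2 := hm2, Ac := Ac, e := e }
  have hbig : ∀ i : TorusPairInst d ℓ amin aplus m2plus, (torusPairFam F d ℓ amin aplus m2plus creg β 1 i).bigBlocks :=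
    fun i => ⟨isBlockUnion_one _, isBlockUnion_one _, fun ν => one_dvd _⟩
  have hregIΩ : (torusPairFam F d ℓ amin aplus m2plus creg β 1 iΩ).regular := hregΩ
  have hregI₀ : (torusPairFam F d ℓ amin aplus m2plus creg β 1 i₀).regular := hreg
  have hregJ : (torusPairFam F d ℓ amin aplus m2plus creg β 1 j).regular := hreg
  -- `gM0T *ᵥ g′ = res (G₀ · ext g′)` and the `res`/`ext` dictionaries
  have hGM : ∀ g' : ↥(fineDom ((ℓ + 1) ^ k) (fineDom (ℓ + 1) ZcT)) × ι → ℝ,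
      gM0T F e hn1 hL1 (B1.aSeq a₀ ((ℓ : ℝ) + 1) k) m2 P' hsub Ac *ᵥ g'
        = resV hXX ((torusOp F e hn1 (B1.aSeq a₀ ((ℓ : ℝ) + 1) k) m2 (per (ℓ + 1) P') (fineDom (ℓ + 1) Z₀cT) Ac)⁻¹
            *ᵥ extV (fineDom ((ℓ + 1) ^ k) (fineDom (ℓ + 1) Z₀cT)) g') :=
    fun g' => (resV_mulVec_extV hXX
      ((torusOp F e hn1 (B1.aSeq a₀ ((ℓ : ℝ) + 1) k) m2 (per (ℓ + 1) P') (fineDom (ℓ + 1) Z₀cT) Ac)⁻¹)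
      (gM0T F e hn1 hL1 (B1.aSeq a₀ ((ℓ : ℝ) + 1) k) m2 P' hsub Ac) (fun _ _ => rfl) g').symm
  refine ⟨?_, ?_, ?_⟩
  · -- (5.4) for `G_k^T(Ω,A)`
    intro g g' U U' hg hg'
    have hm := (H iΩ hregIΩ (hbig iΩ) he hle 0 (0 : Fin (d + 1)) (0 : Fin (d + 1)) g g').1
    have hm' : |g ⬝ᵥ (iΩ.GT F *ᵥ g')| ≤ c₀ * Real.exp (-(δ₀ * tssdist iΩ.P g g')) * Real.sqrt (∑ q, g q ^ 2)
        * Real.sqrt (∑ q, g' q ^ 2) := by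
      have h := hm
      dsimp only [torusPairFam] at h
      rwa [opXT_zero] at h
    exact pair_setForm F iΩ hc₀ hδ₀ g g' U U' hg hg' hm'
  · -- (5.4) for `[G_k^T(Ω₀,A)]_{ΩΩ}`, via the extensions by zero
    intro g g' U U' hg hg'
    set g₀ := extV (fineDom ((ℓ + 1) ^ k) (fineDom (ℓ + 1) Z₀cT)) g with hg₀
    set g₀' := extV (fineDom ((ℓ + 1) ^ k) (fineDom (ℓ + 1) Z₀cT)) g' with hg₀'
    set U₀ : Finset (↥(fineDom ((ℓ + 1) ^ k) (fineDom (ℓ + 1) Z₀cT)) × ι) := U.map ⟨inclι hXX, inclι_injective hXX⟩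
      with hU₀
    set U₀' : Finset (↥(fineDom ((ℓ + 1) ^ k) (fineDom (ℓ + 1) Z₀cT)) × ι) := U'.map ⟨inclι hXX, inclι_injective hXX⟩
      with hU₀'
    have hvan : ∀ (u : ↥(fineDom ((ℓ + 1) ^ k) (fineDom (ℓ + 1) ZcT)) × ι → ℝ)
        (V : Finset (↥(fineDom ((ℓ + 1) ^ k) (fineDom (ℓ + 1) ZcT)) × ι)), (∀ x ∉ V, u x = 0) →
        ∀ q : ↥(fineDom ((ℓ + 1) ^ k) (fineDom (ℓ + 1) Z₀cT)) × ι, q ∉ V.map ⟨inclι hXX, inclι_injective hXX⟩ →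
          extV (fineDom ((ℓ + 1) ^ k) (fineDom (ℓ + 1) Z₀cT)) u q = 0 := by
      intro u V hu q hq
      by_cases hqR : q.1.1 ∈ fineDom ((ℓ + 1) ^ k) (fineDom (ℓ + 1) ZcT)
      · unfold extV
        rw [dif_pos hqR]
        refine hu _ fun hmem => hq (Finset.mem_map.2 ⟨(⟨q.1.1, hqR⟩, q.2), hmem, ?_⟩)
        rfl
      · exact extV_of_not_mem u q hqR
    have hm := (H i₀ hregI₀ (hbig i₀) he hle 0 (0 : Fin (d + 1)) (0 : Fin (d + 1)) g₀ g₀').1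
    have hm' : |g₀ ⬝ᵥ (i₀.GT F *ᵥ g₀')| ≤ c₀ * Real.exp (-(δ₀ * tssdist i₀.P g₀ g₀')) * Real.sqrt (∑ q, g₀ q ^ 2)
        * Real.sqrt (∑ q, g₀' q ^ 2) := by
      have h := hm
      dsimp only [torusPairFam] at h
      rwa [opXT_zero] at h
    have hset := pair_setForm F i₀ hc₀ hδ₀ g₀ g₀' U₀ U₀' (hvan g U hg) (hvan g' U' hg') hm'
    -- identify the pairing and the norms
    have hpair : g ⬝ᵥ (gM0T F e hn1 hL1 (B1.aSeq a₀ ((ℓ : ℝ) + 1) k) m2 P' hsub Ac *ᵥ g') = g₀ ⬝ᵥ (i₀.GT F *ᵥ g₀') := by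
      rw [hGM g', ← extV_dotProduct hXX]
    have hb : ∀ u : ↥(fineDom ((ℓ + 1) ^ k) (fineDom (ℓ + 1) ZcT)) × ι → ℝ,
        bl2n (extV (fineDom ((ℓ + 1) ^ k) (fineDom (ℓ + 1) Z₀cT)) u) = bl2n u :=
      fun u => by unfold bl2n; rw [extV_dotProduct_extV hXX]
    -- the set distance on `Ω₀` of the embedded sets is at least the one on `Ω`
    have hsd : sdistT ((ℓ + 1) ^ k) (ℓ + 1) P' ZcT U U'
        ≤ setDist (fun r w : ↥(fineDom ((ℓ + 1) ^ i₀.k) i₀.ΩT) =>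
            tnorm ((ℓ + 1) ^ i₀.k) i₀.P (r.1 - w.1) / (((ℓ + 1) ^ i₀.k : ℕ) : ℝ)) (U₀.image Prod.fst) (U₀'.image Prod.fst) := by
      by_cases hne : (U₀.image Prod.fst ×ˢ U₀'.image Prod.fst).Nonempty
      · unfold setDist
        rw [dif_pos hne]
        refine Finset.le_inf' _ _ fun q hq => ?_
        obtain ⟨hq1, hq2⟩ := Finset.mem_product.1 hq
        obtain ⟨r₀, hr₀, hr₀'⟩ := Finset.mem_image.1 hq1
        obtain ⟨w₀, hw₀, hw₀'⟩ := Finset.mem_image.1 hq2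
        obtain ⟨r, hr, rfl⟩ := Finset.mem_map.1 hr₀
        obtain ⟨w, hw, rfl⟩ := Finset.mem_map.1 hw₀
        have h1 : r.1 ∈ U.image Prod.fst := Finset.mem_image_of_mem _ hr
        have h2 : w.1 ∈ U'.image Prod.fst := Finset.mem_image_of_mem _ hw
        have h := setDist_le (fun r s : ↥(fineDom ((ℓ + 1) ^ k) (fineDom (ℓ + 1) ZcT)) =>
          tnorm ((ℓ + 1) ^ k) (per (ℓ + 1) P') (r.1 - s.1) / (((ℓ + 1) ^ k : ℕ) : ℝ)) h1 h2
        rw [← hr₀', ← hw₀']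
        exact h
      · unfold setDist
        rw [dif_neg hne]
        -- then one of `U`, `U′` has no site, so `sdistT U U′ = 0`
        have hne' : ¬ ((U.image Prod.fst) ×ˢ (U'.image Prod.fst)).Nonempty := by
          rintro ⟨q, hq⟩
          obtain ⟨hq1, hq2⟩ := Finset.mem_product.1 hq
          obtain ⟨r, hr, hr'⟩ := Finset.mem_image.1 hq1
          obtain ⟨w, hw, hw'⟩ := Finset.mem_image.1 hq2
          refine hne ⟨((inclι hXX r).1, (inclι hXX w).1), Finset.mem_product.2 ⟨?_, ?_⟩⟩
          · exact Finset.mem_image.2 ⟨inclι hXX r, Finset.mem_map.2 ⟨r, hr, rfl⟩, rfl⟩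
          · exact Finset.mem_image.2 ⟨inclι hXX w, Finset.mem_map.2 ⟨w, hw, rfl⟩, rfl⟩
        unfold sdistT setDist
        rw [dif_neg hne']
    rw [hpair]
    refine hset.trans ?_
    rw [hb, hb]
    have h1 : 0 ≤ bl2n g := Real.sqrt_nonneg _
    have h2 : 0 ≤ bl2n g' := Real.sqrt_nonneg _
    exact mul_le_mul_of_nonneg_left (Real.exp_le_exp.2 (neg_le_neg (mul_le_mul_of_nonneg_left hsd hδ₀.le)))
      (by have := hc₀.le; positivity)
  · -- (5.5): the `δG` clause at the instance `Ω ⊂ Ω₀`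
    intro g g' U U' hg hg'
    have hm := (H j hregJ (hbig j) he hle 0 (0 : Fin (d + 1)) (0 : Fin (d + 1)) g g').2
    have hm' : |g ⬝ᵥ (j.GT F *ᵥ g' - j.resT (j.G₀T F *ᵥ j.extT g'))|
        ≤ c₀ * Real.exp (-(δ₀ * tssdist j.P g g')) * Real.exp (-(δ₀ * (tbdistS j.P g + tbdistS j.P g')))
          * Real.sqrt (∑ q, g q ^ 2) * Real.sqrt (∑ q, g' q ^ 2) := by
      have h := hm
      dsimp only [torusPairFam] at h
      rwa [opXT_zero, opX₀T_zero] at h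
    have hset := dpair_setForm F j hc₀ hδ₀ g g' U U' hg hg' hm'
    have hvec : ((torusOp F e hn1 (B1.aSeq a₀ ((ℓ : ℝ) + 1) k) m2 (per (ℓ + 1) P') (fineDom (ℓ + 1) ZcT) Ac)⁻¹
          - gM0T F e hn1 hL1 (B1.aSeq a₀ ((ℓ : ℝ) + 1) k) m2 P' hsub Ac) *ᵥ g'
        = j.GT F *ᵥ g' - j.resT (j.G₀T F *ᵥ j.extT g') := by
      rw [Matrix.sub_mulVec, hGM g', extT_eq_extV j g']
      rfl
    rw [hvec]
    exact hset

end Cor23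

/-! ## §5. (1.19)–(1.20) on the torus at a (1.7)-regular torus field, for every `Λ`, unconditionally at `a_k = aSeq a L k` -/

section Main

variable (F : OrthFlow ι) {ℓ₁ : ℝ} (hℓ₁ : 0 ≤ ℓ₁)
  (hLip : ∀ t (v : ι → ℝ), ((F.U t - 1) *ᵥ v) ⬝ᵥ ((F.U t - 1) *ᵥ v) ≤ (ℓ₁ * t) ^ 2 * (v ⬝ᵥ v))

include hℓ₁ hLip in
/-- **B4 (1.19)–(1.20) ON NESTED REGIONS `Ω ⊂ Ω₀` OF THE DISCRETE TORUS AT A (1.7)-REGULAR TORUS FIELD `A ≠ 0`, EVERY `Λ`**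
(p. 574: «|δC^{(k)}_Λ(Ω,Ω₀,A; x,x′)| ≤ c₀ exp(−δ₀(|x − x′| + dist(x, Ω^{(k)c}) + dist(x′, Ω^{(k)c}))), x, x′ ∈ Λ. (1.20)»;
p. 572 «operators on subsets of a torus T_η»): for a Lipschitz orthogonal flow, `d`, `ℓ ≥ 1` (`L = ℓ+1`), windows
`a ∈ [a₋,a₊]` (`a₋ > 0`), `m² ∈ [0,m²₊]`, `a′ > 0`, (1.7)-constants `(c, β)`, there are `c₀, δ₀, e₁ > 0` (r01 g10's
Corollary-2.3 constants on the torus) such that at every scale `k ≥ 1` (`n = L^k`, `a_k = aSeq a L k`), on every unit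
torus (`P′_ν ≥ 1` `L`-blocks per direction, fine period `≥ 3`), every NESTED pair `Ω^{(k)} = fineDom L Z_T ⊆ Ω₀^{(k)} =
fineDom L Z₀_T` of unions of its `L`-blocks, every torus field with (1.7) on `Ω₀`, `0 < e ≤ e₁` and p17's three smallness
conditions at `a_k`, and EVERY finite `Λ ⊆ Ω^{(k)} × {colours}`: the entries of `C^{(k)}_Λ(Ω,A) − C^{(k)}_Λ(Ω₀,A)` (the
latter through the ambient form matrix `ham0T`, §1) are `≤ c₁e^{−δ₁(|y−y′|_T + dist_T(y,Ω^{(k)c}) + dist_T(y′,Ω^{(k)c}))}`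
with `c₁ = cSt`, `δ₁ = dSt` of the Sect. 5 Theorem at `(N·K_{d+1}, γ₀″(a_k), (a_k²c₀ + a′L^{−2} + a_k)e^{3δ₀(L+1)}, δ₀)` —
THE PRINTED §5 ROUTE pp. 593–594 on the torus: (5.3) for both operators (file 1 + `form115_lower_ambientT`), (5.4) twice
and (5.5) (`cor23_torus_setForm`), the Sect. 5 Theorem (5.9) ⇒ (5.10) via r01's `prop23_120_of_cor23`, with the torus
geometry of file 2 and §3. [cite: Balaban1983RegularityDecay, Prop. 2.3 of [1] (1.19)–(1.20) p.574; (5.3)–(5.5) pp.593–594; Sect. 5 Theorem (5.10) p.594; Cor. 2.3 pp.580–581; p.572 (torus)] -/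
theorem prop23_120_torus_unconditional (ℓ : ℕ) (hℓ : 1 ≤ ℓ) (amin aplus m2plus : ℝ) (ha : 0 < amin)
    {a' : ℝ} (ha' : 0 < a') (creg β : ℝ) (hcreg : 0 ≤ creg) (hβ : 0 < β) :
    ∃ c₀ δ₀ e₁ : ℝ, 0 < c₀ ∧ 0 < δ₀ ∧ 0 < e₁ ∧
      ∀ (k : ℕ) (hk : 1 ≤ k) (P' : Fin (d + 1) → ℕ) (hP' : ∀ ν, 1 ≤ P' ν) (ZcT Z₀cT : Finset (Fin (d + 1) → ℤ))
        (hsub : ZcT ⊆ Z₀cT) (hZ₀ : Z₀cT ⊆ boxDom P') (h3 : ∀ ν, 3 ≤ per ((ℓ + 1) ^ k) (per (ℓ + 1) P') ν)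
        (a₀ m2 : ℝ), amin ≤ a₀ → a₀ ≤ aplus → 0 ≤ m2 → m2 ≤ m2plus →
        ∀ (Ac : (Fin (d + 1) → ℤ) → Fin (d + 1) → ℝ) (e : ℝ),
        (∀ x ∈ fineDom ((ℓ + 1) ^ k) (fineDom (ℓ + 1) Z₀cT), ∀ μ ν : Fin (d + 1),
          |Ac (twrap ((ℓ + 1) ^ k) (per (ℓ + 1) P') (x + e1 μ)) ν - Ac x ν| ≤ creg * e ^ (β - 1) / ((ℓ + 1) ^ k : ℕ)) →
        0 < e → e ≤ e₁ →
        ℓ₁ ^ 2 * ((d + 1) * creg * e ^ β) ^ 2 * (d + 1) * (1 + B1.aSeq a₀ ((ℓ : ℝ) + 1) k * (d + 1))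
          ≤ min 2 (B1.aSeq a₀ ((ℓ : ℝ) + 1) k) / 4 →
        ℓ₁ ^ 2 * ((d + 1) * ((((ℓ + 1 : ℕ) : ℝ)) ^ 2 * creg) * e ^ β) ^ 2 * (d + 1)
          * (1 + (a' / gam0 d (B1.aSeq a₀ ((ℓ : ℝ) + 1) k) m2plus) * (d + 1))
          ≤ min 2 (a' / gam0 d (B1.aSeq a₀ ((ℓ : ℝ) + 1) k) m2plus) / 4 →
        gam0 d (B1.aSeq a₀ ((ℓ : ℝ) + 1) k) m2
          * (6 * (d + 1) * (B1.aSeq a₀ ((ℓ : ℝ) + 1) k / (min 2 (B1.aSeq a₀ ((ℓ : ℝ) + 1) k) / 4 + m2)) ^ 2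
            * (ℓ₁ * ((3 * d + 4) * creg * e ^ β)) ^ 2)
          ≤ gamLow d (ℓ + 1) (B1.aSeq a₀ ((ℓ : ℝ) + 1) k) a' m2plus →
        ∀ (Λ : Finset (↥(fineDom (ℓ + 1) ZcT) × ι)) (y y' : Λ),
        |cLam (covLap (torWt ((ℓ + 1) ^ k) (per (ℓ + 1) P') (fineDom ((ℓ + 1) ^ k) (fineDom (ℓ + 1) ZcT)))
              (fieldLink F (e / ((ℓ + 1) ^ k : ℕ)) fun u v : ↥(fineDom ((ℓ + 1) ^ k) (fineDom (ℓ + 1) ZcT)) =>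
                torBond ((ℓ + 1) ^ k) (per (ℓ + 1) P') Ac u.1 v.1)
              + m2 • (1 : Matrix _ _ ℝ)) (B1.aSeq a₀ ((ℓ : ℝ) + 1) k)
              (QkR F e (Nat.one_le_pow k (ℓ + 1) (Nat.succ_pos ℓ)) (fineDom (ℓ + 1) ZcT)
                (perField ((ℓ + 1) ^ k) (per (ℓ + 1) P') Ac))
              a' ((((ℓ + 1 : ℕ) : ℝ) ^ 2)⁻¹) ((((ℓ + 1) ^ (d + 1) : ℕ) : ℝ))
              (nextAvg F (e / ((ℓ + 1) ^ k : ℕ)) (Nat.succ_le_succ (Nat.zero_le ℓ)) ZcT ((ℓ + 1) ^ k)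
                (perField ((ℓ + 1) ^ k) (per (ℓ + 1) P') Ac)) Λ y y'
          - cLam (ham0T F e (Nat.one_le_pow k (ℓ + 1) (Nat.succ_pos ℓ)) (Nat.succ_le_succ (Nat.zero_le ℓ))
              (B1.aSeq a₀ ((ℓ : ℝ) + 1) k) m2 P' hsub Ac) (B1.aSeq a₀ ((ℓ : ℝ) + 1) k)
              (QkR F e (Nat.one_le_pow k (ℓ + 1) (Nat.succ_pos ℓ)) (fineDom (ℓ + 1) ZcT)
                (perField ((ℓ + 1) ^ k) (per (ℓ + 1) P') Ac))
              a' ((((ℓ + 1 : ℕ) : ℝ) ^ 2)⁻¹) ((((ℓ + 1) ^ (d + 1) : ℕ) : ℝ))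
              (nextAvg F (e / ((ℓ + 1) ^ k : ℕ)) (Nat.succ_le_succ (Nat.zero_le ℓ)) ZcT ((ℓ + 1) ^ k)
                (perField ((ℓ + 1) ^ k) (per (ℓ + 1) P') Ac)) Λ y y'|
          ≤ cSt (profK ι d) (gamLow d (ℓ + 1) (B1.aSeq a₀ ((ℓ : ℝ) + 1) k) a' m2plus)
              ((B1.aSeq a₀ ((ℓ : ℝ) + 1) k ^ 2 * (c₀ * (1 * 1)) + a' * ((((ℓ + 1 : ℕ) : ℝ)) ^ 2)⁻¹
                + B1.aSeq a₀ ((ℓ : ℝ) + 1) k) * Real.exp (3 * (δ₀ * ((((ℓ + 1 : ℕ) : ℝ)) + 1)))) δ₀ *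
            Real.exp (-(dSt (profK ι d) (gamLow d (ℓ + 1) (B1.aSeq a₀ ((ℓ : ℝ) + 1) k) a' m2plus)
              ((B1.aSeq a₀ ((ℓ : ℝ) + 1) k ^ 2 * (c₀ * (1 * 1)) + a' * ((((ℓ + 1 : ℕ) : ℝ)) ^ 2)⁻¹
                + B1.aSeq a₀ ((ℓ : ℝ) + 1) k) * Real.exp (3 * (δ₀ * ((((ℓ + 1 : ℕ) : ℝ)) + 1)))) δ₀ *
              (rhoT (ℓ + 1) P' ZcT y.1 y'.1 + omegaT (ℓ + 1) P' ZcT y.1 + omegaT (ℓ + 1) P' ZcT y'.1))) := by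
  obtain ⟨c₀, δ₀, e₁, hc₀, hδ₀, he₁, HG⟩ :=
    cor23_torus_setForm (d := d) F hℓ₁ hLip ℓ hℓ amin aplus m2plus ha creg β hcreg hβ
  refine ⟨c₀, δ₀, e₁, hc₀, hδ₀, he₁, ?_⟩
  intro k hk P' hP' ZcT Z₀cT hsub hZ₀ h3 a₀ m2 ha1 ha2 hm1 hm2 Ac e hreg he hle hsmall hsmallU hX Λ y y'
  have hL1 : 1 ≤ ℓ + 1 := Nat.succ_le_succ (Nat.zero_le ℓ)
  have hn1 : 1 ≤ (ℓ + 1) ^ k := Nat.one_le_pow k (ℓ + 1) (Nat.succ_pos ℓ)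
  have hL1r : (1 : ℝ) < (ℓ : ℝ) + 1 := by
    have : (1 : ℝ) ≤ ℓ := by exact_mod_cast hℓ
    linarith
  have hL0 : (0 : ℝ) ≤ (((ℓ + 1 : ℕ) : ℝ)) + 1 := by positivity
  have hw : ((((ℓ + 1) ^ (d + 1) : ℕ) : ℝ)) ≠ 0 := by
    have : 0 < (ℓ + 1) ^ (d + 1) := pow_pos (Nat.succ_pos ℓ) _
    exact_mod_cast this.ne'
  have hak : 0 < B1.aSeq a₀ ((ℓ : ℝ) + 1) k := B1.aSeq_pos (lt_of_lt_of_le ha ha1) hL1r hk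
  have hZ : ZcT ⊆ boxDom P' := hsub.trans hZ₀
  have hΩ : fineDom (ℓ + 1) ZcT ⊆ boxDom (per (ℓ + 1) P') := fineDom_subset_perBox hL1 ZcT hZ
  have hregΩ : ∀ x ∈ fineDom ((ℓ + 1) ^ k) (fineDom (ℓ + 1) ZcT), ∀ μ ν : Fin (d + 1),
      |Ac (twrap ((ℓ + 1) ^ k) (per (ℓ + 1) P') (x + e1 μ)) ν - Ac x ν| ≤ creg * e ^ (β - 1) / ((ℓ + 1) ^ k : ℕ) :=
    fun x hx => hreg x (fine_sub hn1 hL1 hsub hx)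
  obtain ⟨hG, hG0, hGd⟩ := HG k hk P' hP' ZcT Z₀cT hsub hZ₀ h3 a₀ m2 ha1 ha2 hm1 hm2 Ac e hreg he hle
  -- the three inputs in r01's `gk`-form (dictionary rewrites `gk_torus_eq`, `gk_ham0T`)
  have hG' : ∀ (g g' : ↥(fineDom ((ℓ + 1) ^ k) (fineDom (ℓ + 1) ZcT)) × ι → ℝ)
      (U U' : Finset (↥(fineDom ((ℓ + 1) ^ k) (fineDom (ℓ + 1) ZcT)) × ι)),
      (∀ x ∉ U, g x = 0) → (∀ x ∉ U', g' x = 0) →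
      |g ⬝ᵥ (gk (covLap (torWt ((ℓ + 1) ^ k) (per (ℓ + 1) P') (fineDom ((ℓ + 1) ^ k) (fineDom (ℓ + 1) ZcT)))
          (fieldLink F (e / ((ℓ + 1) ^ k : ℕ)) fun u v : ↥(fineDom ((ℓ + 1) ^ k) (fineDom (ℓ + 1) ZcT)) =>
            torBond ((ℓ + 1) ^ k) (per (ℓ + 1) P') Ac u.1 v.1)
          + m2 • (1 : Matrix _ _ ℝ)) (B1.aSeq a₀ ((ℓ : ℝ) + 1) k)
          (QkR F e hn1 (fineDom (ℓ + 1) ZcT) (perField ((ℓ + 1) ^ k) (per (ℓ + 1) P') Ac)) *ᵥ g')|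
        ≤ c₀ * bl2n g * bl2n g' * Real.exp (-(δ₀ * sdistT ((ℓ + 1) ^ k) (ℓ + 1) P' ZcT U U')) := by
    intro g g' U U' hg hg'
    rw [gk_torus_eq F e hn1 h3 hΩ Ac (B1.aSeq a₀ ((ℓ : ℝ) + 1) k) m2]
    exact hG g g' U U' hg hg'
  have hG0' : ∀ (g g' : ↥(fineDom ((ℓ + 1) ^ k) (fineDom (ℓ + 1) ZcT)) × ι → ℝ)
      (U U' : Finset (↥(fineDom ((ℓ + 1) ^ k) (fineDom (ℓ + 1) ZcT)) × ι)),
      (∀ x ∉ U, g x = 0) → (∀ x ∉ U', g' x = 0) →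
      |g ⬝ᵥ (gk (ham0T F e hn1 hL1 (B1.aSeq a₀ ((ℓ : ℝ) + 1) k) m2 P' hsub Ac) (B1.aSeq a₀ ((ℓ : ℝ) + 1) k)
          (QkR F e hn1 (fineDom (ℓ + 1) ZcT) (perField ((ℓ + 1) ^ k) (per (ℓ + 1) P') Ac)) *ᵥ g')|
        ≤ c₀ * bl2n g * bl2n g' * Real.exp (-(δ₀ * sdistT ((ℓ + 1) ^ k) (ℓ + 1) P' ZcT U U')) := by
    intro g g' U U' hg hg'
    rw [gk_ham0T F e hn1 hL1 P' hsub Ac hak hm1 hZ₀]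
    exact hG0 g g' U U' hg hg'
  have hGd' : ∀ (g g' : ↥(fineDom ((ℓ + 1) ^ k) (fineDom (ℓ + 1) ZcT)) × ι → ℝ)
      (U U' : Finset (↥(fineDom ((ℓ + 1) ^ k) (fineDom (ℓ + 1) ZcT)) × ι)),
      (∀ x ∉ U, g x = 0) → (∀ x ∉ U', g' x = 0) →
      |g ⬝ᵥ ((gk (covLap (torWt ((ℓ + 1) ^ k) (per (ℓ + 1) P') (fineDom ((ℓ + 1) ^ k) (fineDom (ℓ + 1) ZcT)))
          (fieldLink F (e / ((ℓ + 1) ^ k : ℕ)) fun u v : ↥(fineDom ((ℓ + 1) ^ k) (fineDom (ℓ + 1) ZcT)) =>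
            torBond ((ℓ + 1) ^ k) (per (ℓ + 1) P') Ac u.1 v.1)
          + m2 • (1 : Matrix _ _ ℝ)) (B1.aSeq a₀ ((ℓ : ℝ) + 1) k)
          (QkR F e hn1 (fineDom (ℓ + 1) ZcT) (perField ((ℓ + 1) ^ k) (per (ℓ + 1) P') Ac))
        - gk (ham0T F e hn1 hL1 (B1.aSeq a₀ ((ℓ : ℝ) + 1) k) m2 P' hsub Ac) (B1.aSeq a₀ ((ℓ : ℝ) + 1) k)
          (QkR F e hn1 (fineDom (ℓ + 1) ZcT) (perField ((ℓ + 1) ^ k) (per (ℓ + 1) P') Ac))) *ᵥ g')|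
        ≤ c₀ * bl2n g * bl2n g' * Real.exp (-(δ₀ * (sdistT ((ℓ + 1) ^ k) (ℓ + 1) P' ZcT U U'
            + sdcT ((ℓ + 1) ^ k) (ℓ + 1) P' ZcT U + sdcT ((ℓ + 1) ^ k) (ℓ + 1) P' ZcT U'))) := by
    intro g g' U U' hg hg'
    rw [gk_torus_eq F e hn1 h3 hΩ Ac (B1.aSeq a₀ ((ℓ : ℝ) + 1) k) m2, gk_ham0T F e hn1 hL1 P' hsub Ac hak hm1 hZ₀]
    exact hGd g g' U U' hg hg'
  exact prop23_120_of_cor23 (K := profK ι d) (profK_nonneg (ι := ι))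
    (gamLow_pos d hL1 (B1.aSeq a₀ ((ℓ : ℝ) + 1) k) ha' m2plus)
    (rhoT_isPseudoDist (ι := ι) hL1 hP' ZcT) (rhoT_sumBound (ι := ι) hL1 hP' ZcT hZ) (suppK ZcT hn1)
    (hamT_isSymm F e hn1 h3 hΩ Ac hak hm1) (ham0T_isSymm F e hn1 hL1 P' hsub Ac hak hm1 hZ₀)
    (form115_lower_torus F hn1 hL1 ZcT hZ h3 hℓ₁ hLip he hak ha' hm1 hm2 hcreg hregΩ hsmall hsmallU hX)
    (form115_lower_ambientT F e hn1 hL1 hak hm1 hsub hZ₀ h3 Ac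
      (form115_lower_torus F hn1 hL1 Z₀cT hZ₀ h3 hℓ₁ hLip he hak ha' hm1 hm2 hcreg hreg hsmall hsmallU hX))
    (QkR_row_support ZcT hn1 F e (perField ((ℓ + 1) ^ k) (per (ℓ + 1) P') Ac))
    (QkR_row_sq ZcT hn1 F e (perField ((ℓ + 1) ^ k) (per (ℓ + 1) P') Ac))
    bl2n_sq zero_le_one hc₀.le zero_le_one hak (by positivity) hG' hG0' hGd' hδ₀ hL0
    (fun p q => (rhoT_le_sdistT hn1 hL1 hP' ZcT p q).trans (by push_cast; linarith))
    (fun p q h => (rhoT_le_of_pOp_ne_zero hL1 hP' ZcT F (e / ((ℓ + 1) ^ k : ℕ))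
      (perField ((ℓ + 1) ^ k) (per (ℓ + 1) P') Ac) p q h).trans (by push_cast; linarith))
    (fun p q => abs_pOp_le_one (rowOrtho_nextAvg F (e / ((ℓ + 1) ^ k : ℕ)) hL1 ZcT ((ℓ + 1) ^ k)
      (perField ((ℓ + 1) ^ k) (per (ℓ + 1) P') Ac)) hw p q)
    (omegaT_nonneg (P' := P') ZcT) (omegaT_lip hL1 hP' ZcT)
    (fun p => (omegaT_le_sdcT hn1 hL1 hP' ZcT p).trans (by push_cast; linarith)) Λ y y'

end Main

end

end Literature.MathematicalPhysics.QuantumFieldTheory.Balaban1983to89.B4Ineq120TorusRegular
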